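import Mathlib.Topology.Algebra.ClopenNhdofOne
import Mathlib.Topology.Separation.Profinite
import Literature.RepresentationTheory.HeisenbergGroup.SymplecticPiBigCell
import Literature.RepresentationTheory.HeisenbergGroup.SchrodingerPiOperators
import Literature.NumberTheory.Weil1964.LocalQuadraticGaussIntegralCoefficient
import Literature.NumberTheory.Automorphic.LocalFieldHaarBalls
import HarnessLib

/-!
# Weil's big cell for RANK-ONE SCALAR blocks: the cell data, the kernel phase `ψ(β⁻¹(1−a) x²)`, and the common
# Gauss value on deep boxes along a small open subgroup of a compact torus (the (W2) conjunct of the torus big-cell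
# package)

Topic `RepresentationTheory/HeisenbergGroup`; namespace `Literature.RepresentationTheory.HeisenbergGroup`.
KERNEL mathematics only: theorems, no definition, no named fact, no `sorry`.

Setting of `SymplecticPiBigCell.lean` / `SchrodingerBigCellSection.lean` / `SchrodingerBigCellTrace.lean`: `𝕍 = F^ι × F^ι` with
its blocks `A, B, C, D` and, on Weil's big cell `Ω = {B invertible}`, the cell data `cellB = B`, `γ = D B⁻¹`, `δ = B⁻¹ A` of
the canonical word `g = n(γ) m(B) w n(δ)` whose Schrödinger-model kernel has the diagonal phase
`ψ(x·B⁻¹x − ½⟨x,γx⟩ − ½⟨x,δx⟩)` ([Weil1964] n° 13 (29)).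

* §1 SCALAR BLOCKS (any field, any `ι`): if `g(x, y) = (a x + β y, c x + d y)` with SCALARS `a β c d` (the shape of the
  conjugated rank-one torus element `e ι_v(z) e⁻¹`, `z ∈ E_v¹`, whose blocks are `a = d = Re ζ_z`, `β = d_E · Im ζ_z · τ⁻¹`),
  then `B = β·id` is invertible iff `β ≠ 0`, `B⁻¹ = β⁻¹·id`, `γ = dβ⁻¹·id`, `δ = β⁻¹a·id`, and the phase is the ONE
  quadratic form `β⁻¹(1 − (a+d)/2)·⟨x,x⟩` — for the torus (`d = a`) and `ι = Fin 1`: `β⁻¹(1 − a)·x₀²`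
  (`bigCellPhase_eq_of_scalar`, `bigCellPhase_fin_one_eq_of_scalar`).
* §2 GAUSS VALUE (non-archimedean local `F`, `ι = Fin 1`): the box integral of the phase character is Weil's Gauss integral
  `g(β⁻¹(1−a), 𝔭ⁿ)` (`setIntegral_primePowPiBox_bigCellPhase_of_scalar`), hence — by the local constancy of Gauss integrals
  in the coefficient (`Weil1964.exists_forall_gaussBall_eq_weilGauss_of_sub_mem`) — for `(a₀, β₀)` with `β₀ ≠ 0`,
  `a₀ ≠ 1` there are `N, m₀` and `Gv = g(β₀⁻¹(1−a₀)) ≠ 0` with `∫_{(𝔭ⁿ)¹} ψ(phase) = Gv` for EVERY scalar-block `g` whose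
  coefficient `β⁻¹(1−a)` is `𝔭^N`-close to `β₀⁻¹(1−a₀)` and every `n ≤ m₀` (`exists_gaussValue_of_scalar`).
* §3 ALONG A COMPACT TORUS: for a compact totally disconnected group `G` (the non-split torus `E_v¹`), continuous
  `a β : G → F` and `z₀` with `β z₀ ≠ 0`, `a z₀ ≠ 1` (i.e. `z₀² ≠ 1`), there is an OPEN SUBGROUP `K₀` on whose coset
  `z₀K₀` the valuations of `β` and `1 − a` are constant, `β ≠ 0`, and the deep box integrals of the phases of ALL the
  scalar-block elements `(a(z₀k), β(z₀k))` have the common non-zero value `Gv` (`exists_openSubgroup_gaussValue_of_scalar`)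
  — open neighbourhoods of `1` in a profinite group contain open subgroups (`exists_openSubgroup_subset_of_isOpen`).

This is conjunct (W2) «common Gauss value `Gv ≠ 0` on deep boxes» (plus the bijectivity of `B` and the valuation
constancies feeding (W1)/(W3)) of the hypothesis `hpkg` of
`MoeglinVignerasWaldspurger1987.rankOne_torusTrace_ne_zero_of_bigCellPackage` (the finite-level character
non-vanishing TR of the rank-`1 × 1` oscillator representation; cell `hodgecm-mathlib`, c3 wall, H1), stated for ABSTRACT
scalar blocks so that it lands independently of the coordinate computation `e ι_v(z) e⁻¹ = (a x + d b τ⁻¹ y, τ b x + a y)`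
of the torus file; the integrator instantiates `a := Re ζ`, `β := d·Im ζ·τ⁻¹`.  HC_CM is not advanced by this file alone.

## References
* [Weil1964] A. Weil, *Sur certains groupes d'opérateurs unitaires*, Acta Math. 111 (1964), n° 7 Prop. 1 (p. 152: the cell
  `Ω` and `γ, δ`), n° 13 (29) (p. 160: the kernel of `r(g)` on `Ω`), Chap. II n° 27 (pp. 174–175: `g(f, M)`).
* [MoeglinVignerasWaldspurger1987] C. Mœglin, M.-F. Vignéras, J.-L. Waldspurger, LNM 1291 (1987), Chap. 2 II.8 (smooth
  vectors, open compact subgroups).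
-/

set_option autoImplicit false

noncomputable section

open MeasureTheory Matrix Set
open scoped NNReal
open Literature.NumberTheory.GaloisRepresentations.IsNonarchimedeanLocalField
open Literature.NumberTheory.Automorphic
open Literature.NumberTheory.Weil1964

namespace Literature.RepresentationTheory.HeisenbergGroup

/-! ## §1 Scalar blocks: `B = β`, `B⁻¹ = β⁻¹`, `γ = d β⁻¹`, `δ = β⁻¹ a`, phase `β⁻¹ (1 − (a+d)/2) ⟨x, x⟩` -/

section Scalar

variable {F : Type*} [Field F] {ι : Type*} (g : ((ι → F) × (ι → F)) ≃ₗ[F] ((ι → F) × (ι → F))) {a β c d : F}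

/-- the block `B` of `g(x,y) = (a x + β y, ·)` is the scalar `β`. [cite: Weil1964, n° 3, p. 147] -/
theorem blockB_apply_of_scalar (hg₁ : ∀ x y : ι → F, (g (x, y)).1 = a • x + β • y) (y : ι → F) :
    blockB g y = β • y := by
  rw [blockB_apply, hg₁, smul_zero, zero_add]

/-- the block `A` of `g(x,y) = (a x + β y, ·)` is the scalar `a`. [cite: Weil1964, n° 3, p. 147] -/
theorem blockA_apply_of_scalar (hg₁ : ∀ x y : ι → F, (g (x, y)).1 = a • x + β • y) (x : ι → F) :
    blockA g x = a • x := by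
  rw [blockA_apply, hg₁, smul_zero, add_zero]

/-- the block `D` of `g(x,y) = (·, c x + d y)` is the scalar `d`. [cite: Weil1964, n° 3, p. 147] -/
theorem blockD_apply_of_scalar (hg₂ : ∀ x y : ι → F, (g (x, y)).2 = c • x + d • y) (y : ι → F) :
    blockD g y = d • y := by
  rw [blockD_apply, hg₂, smul_zero, zero_add]

/-- the block `C` of `g(x,y) = (·, c x + d y)` is the scalar `c`. [cite: Weil1964, n° 3, p. 147] -/
theorem blockC_apply_of_scalar (hg₂ : ∀ x y : ι → F, (g (x, y)).2 = c • x + d • y) (x : ι → F) :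
    blockC g x = c • x := by
  rw [blockC_apply, hg₂, smul_zero, add_zero]

/-- **`g` lies in the big cell iff `β ≠ 0`** (forward half used: `β ≠ 0 ⇒ B = β·id` bijective).
[cite: Weil1964, n° 7 Prop. 1, p. 152] -/
theorem bijective_blockB_of_scalar (hg₁ : ∀ x y : ι → F, (g (x, y)).1 = a • x + β • y) (hβ : β ≠ 0) :
    Function.Bijective (blockB g) := by
  have e : (blockB g : (ι → F) → (ι → F)) = fun y => β • y := funext (blockB_apply_of_scalar g hg₁)
  rw [e]
  exact ⟨fun y y' h => smul_right_injective (ι → F) hβ h, fun x => ⟨β⁻¹ • x, by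
    simp only [smul_smul, mul_inv_cancel₀ hβ, one_smul]⟩⟩

/-- conversely a bijective scalar block is non-zero (when `ι` is non-empty). [cite: Weil1964, n° 7 Prop. 1, p. 152] -/
theorem ne_zero_of_bijective_blockB_of_scalar [Nonempty ι] (hg₁ : ∀ x y : ι → F, (g (x, y)).1 = a • x + β • y)
    (hB : Function.Bijective (blockB g)) : β ≠ 0 := by
  rintro rfl
  obtain ⟨i⟩ := ‹Nonempty ι›
  have h1 : blockB g (fun _ => 1) = blockB g 0 := by
    rw [blockB_apply_of_scalar g hg₁, blockB_apply_of_scalar g hg₁, zero_smul, zero_smul]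
  exact one_ne_zero (congrFun (hB.1 h1) i)

/-- **`B⁻¹ = β⁻¹·id`** on the big cell. [cite: Weil1964, n° 7 Prop. 1, p. 152] -/
theorem cellB_symm_apply_of_scalar (hg₁ : ∀ x y : ι → F, (g (x, y)).1 = a • x + β • y)
    (hB : Function.Bijective (blockB g)) (hβ : β ≠ 0) (x : ι → F) : (cellB g hB).symm x = β⁻¹ • x := by
  rw [LinearEquiv.symm_apply_eq, cellB_apply, blockB_apply_of_scalar g hg₁, smul_smul, mul_inv_cancel₀ hβ, one_smul]

/-- **`γ = D B⁻¹ = d β⁻¹·id`**. [cite: Weil1964, n° 7 Prop. 1, p. 152] -/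
theorem cellGamma_apply_of_scalar (hg₁ : ∀ x y : ι → F, (g (x, y)).1 = a • x + β • y)
    (hg₂ : ∀ x y : ι → F, (g (x, y)).2 = c • x + d • y) (hB : Function.Bijective (blockB g)) (hβ : β ≠ 0)
    (x : ι → F) : cellGamma g hB x = (d * β⁻¹) • x := by
  rw [cellGamma_apply, cellB_symm_apply_of_scalar g hg₁ hB hβ, blockD_apply_of_scalar g hg₂, smul_smul]

/-- **`δ = B⁻¹ A = β⁻¹ a·id`**. [cite: Weil1964, n° 7 Prop. 1, p. 152] -/
theorem cellDelta_apply_of_scalar (hg₁ : ∀ x y : ι → F, (g (x, y)).1 = a • x + β • y)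
    (hB : Function.Bijective (blockB g)) (hβ : β ≠ 0) (x : ι → F) : cellDelta g hB x = (β⁻¹ * a) • x := by
  rw [cellDelta_apply, blockA_apply_of_scalar g hg₁, cellB_symm_apply_of_scalar g hg₁ hB hβ, smul_smul]

/-- bundled: **`B = β·1` as a linear equivalence** (`LinearEquiv.smulOfNeZero`), the currency of the torus package's
witness `B_ k`. [cite: Weil1964, n° 7 Prop. 1, p. 152] -/
theorem cellB_eq_smulOfNeZero_of_scalar (hg₁ : ∀ x y : ι → F, (g (x, y)).1 = a • x + β • y)
    (hB : Function.Bijective (blockB g)) (hβ : β ≠ 0) : cellB g hB = LinearEquiv.smulOfNeZero F (ι → F) β hβ :=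
  LinearEquiv.ext fun y => by rw [cellB_apply, blockB_apply_of_scalar g hg₁, LinearEquiv.smulOfNeZero_apply]

/-- bundled: **`γ = (d β⁻¹) • 1`** as a linear map. [cite: Weil1964, n° 7 Prop. 1, p. 152] -/
theorem cellGamma_eq_smul_id_of_scalar (hg₁ : ∀ x y : ι → F, (g (x, y)).1 = a • x + β • y)
    (hg₂ : ∀ x y : ι → F, (g (x, y)).2 = c • x + d • y) (hB : Function.Bijective (blockB g)) (hβ : β ≠ 0) :
    cellGamma g hB = (d * β⁻¹) • (LinearMap.id : (ι → F) →ₗ[F] (ι → F)) :=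
  LinearMap.ext fun x => by rw [cellGamma_apply_of_scalar g hg₁ hg₂ hB hβ, LinearMap.smul_apply, LinearMap.id_apply]

/-- bundled: **`δ = (β⁻¹ a) • 1`** as a linear map. [cite: Weil1964, n° 7 Prop. 1, p. 152] -/
theorem cellDelta_eq_smul_id_of_scalar (hg₁ : ∀ x y : ι → F, (g (x, y)).1 = a • x + β • y)
    (hB : Function.Bijective (blockB g)) (hβ : β ≠ 0) :
    cellDelta g hB = (β⁻¹ * a) • (LinearMap.id : (ι → F) →ₗ[F] (ι → F)) :=
  LinearMap.ext fun x => by rw [cellDelta_apply_of_scalar g hg₁ hB hβ, LinearMap.smul_apply, LinearMap.id_apply]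

/-- **THE PHASE OF THE BIG-CELL KERNEL FOR SCALAR BLOCKS**: `x·B⁻¹x − ½⟨x, γx⟩ − ½⟨x, δx⟩ = β⁻¹ (1 − ½(a + d)) ⟨x, x⟩`.
[cite: Weil1964, n° 13 (29), p. 160] -/
theorem bigCellPhase_eq_of_scalar [Fintype ι] [Invertible (2 : F)] (hg₁ : ∀ x y : ι → F, (g (x, y)).1 = a • x + β • y)
    (hg₂ : ∀ x y : ι → F, (g (x, y)).2 = c • x + d • y) (hB : Function.Bijective (blockB g)) (hβ : β ≠ 0)
    (x : ι → F) :
    x ⬝ᵥ (cellB g hB).symm x - halfForm (cellGamma g hB) x - halfForm (cellDelta g hB) x =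
      (β⁻¹ * (1 - ⅟(2 : F) * (a + d))) * (x ⬝ᵥ x) := by
  rw [halfForm_apply, halfForm_apply, cellB_symm_apply_of_scalar g hg₁ hB hβ,
    cellGamma_apply_of_scalar g hg₁ hg₂ hB hβ, cellDelta_apply_of_scalar g hg₁ hB hβ, dotProduct_smul, dotProduct_smul,
    dotProduct_smul, smul_eq_mul, smul_eq_mul, smul_eq_mul]
  ring

/-- the TORUS case `d = a`: the phase is `β⁻¹ (1 − a) ⟨x, x⟩`. [cite: Weil1964, n° 13 (29), p. 160] -/
theorem bigCellPhase_eq_of_scalar_torus [Fintype ι] [Invertible (2 : F)] (hg₁ : ∀ x y : ι → F, (g (x, y)).1 = a • x + β • y)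
    (hg₂ : ∀ x y : ι → F, (g (x, y)).2 = c • x + a • y) (hB : Function.Bijective (blockB g)) (hβ : β ≠ 0)
    (x : ι → F) :
    x ⬝ᵥ (cellB g hB).symm x - halfForm (cellGamma g hB) x - halfForm (cellDelta g hB) x = (β⁻¹ * (1 - a)) * (x ⬝ᵥ x) := by
  rw [bigCellPhase_eq_of_scalar g hg₁ hg₂ hB hβ]
  have h2 : ⅟(2 : F) * (a + a) = a := by rw [← two_mul, invOf_mul_cancel_left']
  rw [h2]

end Scalar

section FinOne

variable {F : Type*} [Field F] (g : ((Fin 1 → F) × (Fin 1 → F)) ≃ₗ[F] ((Fin 1 → F) × (Fin 1 → F))) {a β c : F}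

/-- on `F¹`, `⟨x, x⟩ = x₀²`. [folklore] -/
private theorem dotProduct_self_fin_one (x : Fin 1 → F) : x ⬝ᵥ x = x 0 ^ 2 := by
  rw [dotProduct, Fin.sum_univ_one, sq]

/-- **RANK ONE, TORUS**: the phase of the big-cell kernel of `g(x,y) = (a x + β y, c x + a y)` on `F¹ × F¹` is the
one-variable quadratic form `β⁻¹(1 − a)·x₀²` — the argument of Weil's Gauss integral `g(β⁻¹(1−a)·x², ·)`.
[cite: Weil1964, n° 13 (29), p. 160; Chap. II n° 27, p. 175] -/
theorem bigCellPhase_fin_one_eq_of_scalar [Invertible (2 : F)] (hg₁ : ∀ x y : Fin 1 → F, (g (x, y)).1 = a • x + β • y)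
    (hg₂ : ∀ x y : Fin 1 → F, (g (x, y)).2 = c • x + a • y) (hB : Function.Bijective (blockB g)) (hβ : β ≠ 0)
    (x : Fin 1 → F) :
    x ⬝ᵥ (cellB g hB).symm x - halfForm (cellGamma g hB) x - halfForm (cellDelta g hB) x = (β⁻¹ * (1 - a)) * x 0 ^ 2 := by
  rw [bigCellPhase_eq_of_scalar_torus g hg₁ hg₂ hB hβ, dotProduct_self_fin_one]

/-- **RANK ONE, HOMOTHETY CURRENCY** (the witnesses of the torus package: `B = βv • 1` as `LinearEquiv.smulOfNeZero`,
`γ = δ = γv • 1`): the phase is `(βv⁻¹ − γv)·x₀²`. [cite: Weil1964, n° 13 (29), p. 160; Chap. II n° 27, p. 175] -/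
theorem bigCellPhase_fin_one_eq_of_smul [Invertible (2 : F)] (βv γv : F) (hβv0 : βv ≠ 0) (x : Fin 1 → F) :
    x ⬝ᵥ (LinearEquiv.smulOfNeZero F (Fin 1 → F) βv hβv0).symm x - halfForm (γv • LinearMap.id) x -
        halfForm (γv • LinearMap.id) x = (βv⁻¹ - γv) * x 0 ^ 2 := by
  have hsymm : (LinearEquiv.smulOfNeZero F (Fin 1 → F) βv hβv0).symm x = βv⁻¹ • x := by
    rw [LinearEquiv.symm_apply_eq, LinearEquiv.smulOfNeZero_apply, smul_smul, mul_inv_cancel₀ hβv0, one_smul]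
  rw [hsymm, halfForm_apply, LinearMap.smul_apply, LinearMap.id_apply, dotProduct_smul, dotProduct_smul, smul_eq_mul,
    smul_eq_mul, dotProduct_self_fin_one]
  have h2 : (⅟(2 : F)) * (γv * x 0 ^ 2) + ⅟(2 : F) * (γv * x 0 ^ 2) = γv * x 0 ^ 2 := by
    rw [← two_mul, mul_invOf_cancel_left']
  linear_combination -h2

end FinOne

/-! ## §2 The box integral of the phase character is Weil's Gauss integral; the common value on deep boxes -/

/-- `2 ≠ 0` in a field where `2` is invertible. [folklore] -/
private theorem two_ne_zero_of_invertible {F : Type*} [Field F] [Invertible (2 : F)] : (2 : F) ≠ 0 :=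
  (isUnit_of_invertible (2 : F)).ne_zero

section Gauss

variable {F : Type*} [Field F] [ValuativeRel F] [TopologicalSpace F] [IsNonarchimedeanLocalField F]
  [Invertible (2 : F)] {ψ : AddChar F Circle} [MeasurableSpace F] [BorelSpace F] (μ : Measure F)

/-- **the (W2) integrand is a one-variable second-degree character**: for scalar torus blocks,
`∫_{(𝔭ⁿ)¹} ψ(x·B⁻¹x − ½⟨x,γx⟩ − ½⟨x,δx⟩) dμ¹ = g(β⁻¹(1−a), 𝔭ⁿ)` (`Weil1964.gaussBall`).
[cite: Weil1964, n° 13 (29), p. 160; Chap. II n° 27, p. 175] -/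
theorem setIntegral_primePowPiBox_bigCellPhase_of_scalar
    (g : ((Fin 1 → F) × (Fin 1 → F)) ≃ₗ[F] ((Fin 1 → F) × (Fin 1 → F))) {a β c : F}
    (hg₁ : ∀ x y : Fin 1 → F, (g (x, y)).1 = a • x + β • y) (hg₂ : ∀ x y : Fin 1 → F, (g (x, y)).2 = c • x + a • y)
    (hB : Function.Bijective (blockB g)) (hβ : β ≠ 0) (n : ℤ) :
    ∫ x in primePowPiBox F (Fin 1) n,
        ((ψ (x ⬝ᵥ (cellB g hB).symm x - halfForm (cellGamma g hB) x - halfForm (cellDelta g hB) x) : Circle) : ℂ)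
          ∂(Measure.pi fun _ : Fin 1 => μ) =
      gaussBall ψ μ (β⁻¹ * (1 - a)) n := by
  rw [← setIntegral_primePowPiBox_psiSq_fin_one μ (β⁻¹ * (1 - a)) n]
  refine setIntegral_congr_fun (measurableSet_primePowPiBox n) fun x _ => ?_
  rw [bigCellPhase_fin_one_eq_of_scalar g hg₁ hg₂ hB hβ, psiSq_apply]

/-- the same in HOMOTHETY CURRENCY: `∫_{(𝔭ⁿ)¹} ψ(x·(βv•1)⁻¹x − ½⟨x,γv x⟩ − ½⟨x,γv x⟩) dμ¹ = g(βv⁻¹ − γv, 𝔭ⁿ)`.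
[cite: Weil1964, n° 13 (29), p. 160; Chap. II n° 27, p. 175] -/
theorem setIntegral_primePowPiBox_bigCellPhase_of_smul (βv γv : F) (hβv0 : βv ≠ 0) (n : ℤ) :
    ∫ x in primePowPiBox F (Fin 1) n,
        ((ψ (x ⬝ᵥ (LinearEquiv.smulOfNeZero F (Fin 1 → F) βv hβv0).symm x - halfForm (γv • LinearMap.id) x -
            halfForm (γv • LinearMap.id) x) : Circle) : ℂ) ∂(Measure.pi fun _ : Fin 1 => μ) =
      gaussBall ψ μ (βv⁻¹ - γv) n := by
  rw [← setIntegral_primePowPiBox_psiSq_fin_one μ (βv⁻¹ - γv) n]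
  refine setIntegral_congr_fun (measurableSet_primePowPiBox n) fun x _ => ?_
  rw [bigCellPhase_fin_one_eq_of_smul βv γv hβv0, psiSq_apply]

variable [μ.IsAddHaarMeasure]

/-- **(W2) IN HOMOTHETY CURRENCY — the common Gauss value on deep boxes**: for `ψ` of conductor exponent `m` and a base
coefficient `A₀ ≠ 0` there are `N m₀` and `Gv = g(A₀) ≠ 0` with `∫_{(𝔭ⁿ)¹} ψ(phase) dμ¹ = Gv` for ALL homothety cells
`(βv • 1, γv • 1, γv • 1)` whose coefficient `βv⁻¹ − γv` is `𝔭^N`-close to `A₀`, and all `n ≤ m₀`.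
[cite: Weil1964, n° 13 (29), p. 160; Chap. II n° 27, p. 175] -/
theorem exists_gaussValue_of_smul (hψ : ψ.IsContinuousNontrivial) {m : ℤ} (hm : ψ.HasConductorExp m) {A₀ : F}
    (hA₀ : A₀ ≠ 0) :
    ∃ (N m₀ : ℤ) (Gv : ℂ), Gv ≠ 0 ∧ ∀ (βv γv : F) (hβv0 : βv ≠ 0), βv⁻¹ - γv - A₀ ∈ primePowBall F N →
      ∀ n ≤ m₀, ∫ x in primePowPiBox F (Fin 1) n,
        ((ψ (x ⬝ᵥ (LinearEquiv.smulOfNeZero F (Fin 1 → F) βv hβv0).symm x - halfForm (γv • LinearMap.id) x -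
            halfForm (γv • LinearMap.id) x) : Circle) : ℂ) ∂(Measure.pi fun _ : Fin 1 => μ) = Gv := by
  obtain ⟨m₀, N, h⟩ := exists_forall_gaussBall_eq_weilGauss_of_sub_mem μ hm hA₀ two_ne_zero_of_invertible
  refine ⟨N, m₀, weilGauss ψ μ A₀, weilGauss_ne_zero μ hψ hA₀ two_ne_zero_of_invertible, fun βv γv hβv0 hmem n hn => ?_⟩
  rw [setIntegral_primePowPiBox_bigCellPhase_of_smul μ βv γv hβv0 n]
  exact h _ hmem n hn

/-- **(W2) FOR SCALAR TORUS BLOCKS — the common Gauss value on deep boxes**: for `ψ` of conductor exponent `m`, and a base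
point `(a₀, β₀)` with `β₀ ≠ 0`, `a₀ ≠ 1`, there are `N m₀ : ℤ` and `Gv = g(β₀⁻¹(1−a₀)) ≠ 0` (Weil's stable Gauss value) such
that for EVERY `g` with scalar torus blocks `(a, β, c, a)` on the big cell whose coefficient `β⁻¹(1−a)` is `𝔭^N`-close to
`β₀⁻¹(1−a₀)`, and every `n ≤ m₀`, `∫_{(𝔭ⁿ)¹} ψ(x·B⁻¹x − ½⟨x,γx⟩ − ½⟨x,δx⟩) dμ¹ = Gv`.
[cite: Weil1964, n° 13 (29), p. 160; Chap. II n° 27, p. 175] -/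
theorem exists_gaussValue_of_scalar (hψ : ψ.IsContinuousNontrivial) {m : ℤ} (hm : ψ.HasConductorExp m) {a₀ β₀ : F}
    (hβ₀ : β₀ ≠ 0) (ha₀ : a₀ ≠ 1) :
    ∃ (N m₀ : ℤ) (Gv : ℂ), Gv ≠ 0 ∧
      ∀ (g : ((Fin 1 → F) × (Fin 1 → F)) ≃ₗ[F] ((Fin 1 → F) × (Fin 1 → F))) (a β c : F),
        (∀ x y : Fin 1 → F, (g (x, y)).1 = a • x + β • y) → (∀ x y : Fin 1 → F, (g (x, y)).2 = c • x + a • y) →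
        ∀ (hB : Function.Bijective (blockB g)), β ≠ 0 → β⁻¹ * (1 - a) - β₀⁻¹ * (1 - a₀) ∈ primePowBall F N →
        ∀ n ≤ m₀, ∫ x in primePowPiBox F (Fin 1) n,
            ((ψ (x ⬝ᵥ (cellB g hB).symm x - halfForm (cellGamma g hB) x - halfForm (cellDelta g hB) x) : Circle) : ℂ)
              ∂(Measure.pi fun _ : Fin 1 => μ) = Gv := by
  have hα₀ : β₀⁻¹ * (1 - a₀) ≠ 0 := mul_ne_zero (inv_ne_zero hβ₀) (sub_ne_zero.2 (Ne.symm ha₀))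
  obtain ⟨m₀, N, h⟩ := exists_forall_gaussBall_eq_weilGauss_of_sub_mem μ hm hα₀ two_ne_zero_of_invertible
  refine ⟨N, m₀, weilGauss ψ μ (β₀⁻¹ * (1 - a₀)), weilGauss_ne_zero μ hψ hα₀ two_ne_zero_of_invertible,
    fun g a β c hg₁ hg₂ hB hβ hmem n hn => ?_⟩
  rw [setIntegral_primePowPiBox_bigCellPhase_of_scalar μ g hg₁ hg₂ hB hβ n]
  exact h _ hmem n hn

end Gauss

/-! ## §3 Along a compact totally disconnected torus: an open subgroup with a common Gauss value -/

section Torus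

/-- **valuations are locally constant along the torus** (pointwise ultrametric bookkeeping): for `φ : G → F` into a
non-archimedean local field, `‖φ(z₀k) − φ z₀‖ < ‖φ z₀‖ ⇒ ‖φ(z₀k)‖ = ‖φ z₀‖`. [cite: Weil1964, Chap. II n° 27, p. 175] -/
theorem normAbs_eq_of_normAbs_sub_lt' {G : Type*} [Mul G] {F : Type*} [Field F] [ValuativeRel F] [TopologicalSpace F]
    [IsNonarchimedeanLocalField F] {φ : G → F} {z₀ k : G} (h : normAbs F (φ (z₀ * k) - φ z₀) < normAbs F (φ z₀)) :
    normAbs F (φ (z₀ * k)) = normAbs F (φ z₀) := by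
  have h' : normAbs F (φ z₀ - φ (z₀ * k)) < normAbs F (φ z₀) := by rwa [← normAbs_neg, neg_sub]
  exact normAbs_eq_of_normAbs_sub_lt h'

variable {G : Type*} [Group G] [TopologicalSpace G] [IsTopologicalGroup G] [CompactSpace G] [T2Space G]
  [TotallyDisconnectedSpace G]

/-- **open neighbourhoods of `1` in a profinite group contain open subgroups** (clopen shrink
`compact_exists_isClopen_in_isOpen` + Mathlib's `exist_openSubgroup_sub_clopen_nhds_of_one`).
[cite: MoeglinVignerasWaldspurger1987, Chap. 2 II.8] -/
theorem exists_openSubgroup_subset_of_isOpen {U : Set G} (hU : IsOpen U) (h1 : (1 : G) ∈ U) :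
    ∃ K : Subgroup G, IsOpen (K : Set G) ∧ (K : Set G) ⊆ U := by
  obtain ⟨C, hC, h1C, hCU⟩ := compact_exists_isClopen_in_isOpen hU h1
  obtain ⟨K, hK⟩ := IsTopologicalGroup.exist_openSubgroup_sub_clopen_nhds_of_one hC h1C
  exact ⟨K, K.isOpen, hK.trans hCU⟩

variable {F : Type*} [Field F] [ValuativeRel F] [TopologicalSpace F] [IsNonarchimedeanLocalField F]
  [Invertible (2 : F)] {ψ : AddChar F Circle} [MeasurableSpace F] [BorelSpace F] (μ : Measure F) [μ.IsAddHaarMeasure]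

/-- **(W2) ALONG THE TORUS — an open subgroup with a common non-zero Gauss value.**  For a compact totally disconnected
group `G` (the non-split torus `U(J₁)(F_v) = E_v¹`), CONTINUOUS coordinate functions `a β : G → F` (real part and rescaled
imaginary part of `ζ_z`) and `z₀` with `β z₀ ≠ 0`, `a z₀ ≠ 1` (i.e. `z₀² ≠ 1`): there is an open subgroup `K₀` such that on
the coset `z₀K₀` (i) `β ≠ 0` with `‖β‖` and `‖1 − a‖` CONSTANT, and (ii) for `Gv ≠ 0`, `m₀` independent of `k`: every
`g` with scalar torus blocks `(a(z₀k), β(z₀k), c, a(z₀k))` on `F¹ × F¹` (any `c`, any proof that its `B` is bijective) has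
`∫_{(𝔭ⁿ)¹} ψ(x·B⁻¹x − ½⟨x,γx⟩ − ½⟨x,δx⟩) dμ¹ = Gv` for all `n ≤ m₀`.
[cite: Weil1964, n° 13 (29), p. 160; Chap. II n° 27, p. 175] [cite: MoeglinVignerasWaldspurger1987, Chap. 2 II.8] -/
theorem exists_openSubgroup_gaussValue_of_scalar (hψ : ψ.IsContinuousNontrivial) {m : ℤ} (hm : ψ.HasConductorExp m)
    (a β : G → F) (ha : Continuous a) (hβ : Continuous β) (z₀ : G) (hβ₀ : β z₀ ≠ 0) (ha₀ : a z₀ ≠ 1) :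
    ∃ K₀ : Subgroup G, IsOpen (K₀ : Set G) ∧ ∃ (Gv : ℂ) (m₀ : ℤ), Gv ≠ 0 ∧
      ∀ k ∈ K₀, β (z₀ * k) ≠ 0 ∧ normAbs F (β (z₀ * k)) = normAbs F (β z₀) ∧
        normAbs F (1 - a (z₀ * k)) = normAbs F (1 - a z₀) ∧
        ∀ (g : ((Fin 1 → F) × (Fin 1 → F)) ≃ₗ[F] ((Fin 1 → F) × (Fin 1 → F))) (c : F),
          (∀ x y : Fin 1 → F, (g (x, y)).1 = a (z₀ * k) • x + β (z₀ * k) • y) →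
          (∀ x y : Fin 1 → F, (g (x, y)).2 = c • x + a (z₀ * k) • y) →
          ∀ (hB : Function.Bijective (blockB g)), ∀ n ≤ m₀,
            ∫ x in primePowPiBox F (Fin 1) n,
              ((ψ (x ⬝ᵥ (cellB g hB).symm x - halfForm (cellGamma g hB) x - halfForm (cellDelta g hB) x) : Circle) : ℂ)
                ∂(Measure.pi fun _ : Fin 1 => μ) = Gv := by
  obtain ⟨N, m₀, Gv, hGv, hval⟩ := exists_gaussValue_of_scalar μ hψ hm hβ₀ ha₀
  -- the coefficient of the phase along the torus, continuous where `β ≠ 0`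
  set α : G → F := fun z => (β z)⁻¹ * (1 - a z) with hα
  have h1a₀ : (1 : F) - a z₀ ≠ 0 := sub_ne_zero.2 (Ne.symm ha₀)
  have hβc : Continuous fun k : G => β (z₀ * k) := hβ.comp (continuous_const.mul continuous_id)
  have hac : Continuous fun k : G => 1 - a (z₀ * k) := continuous_const.sub (ha.comp (continuous_const.mul continuous_id))
  -- the open neighbourhood of `1` on which everything is controlled
  haveI : T2Space F := (Literature.NumberTheory.GaloisRepresentations.IsNonarchimedeanLocalField.isLocalField F).toT2Space
  set V : Set G := {k | β (z₀ * k) ≠ 0} with hV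
  have hVo : IsOpen V := isOpen_ne_fun hβc continuous_const
  have hαc : ContinuousOn (fun k : G => α (z₀ * k) - α z₀) V :=
    ((hβc.continuousOn.inv₀ fun k hk => hk).mul hac.continuousOn).sub continuousOn_const
  set U : Set G := {k | normAbs F (β (z₀ * k) - β z₀) < normAbs F (β z₀)} ∩
    {k | normAbs F ((1 - a (z₀ * k)) - (1 - a z₀)) < normAbs F (1 - a z₀)} ∩
    (V ∩ (fun k : G => α (z₀ * k) - α z₀) ⁻¹' primePowBall F N) with hU
  have hUo : IsOpen U := by
    refine ((isOpen_lt (LocalFieldHaar.continuous_normAbs.comp (hβc.sub continuous_const)) continuous_const).inter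
      (isOpen_lt (LocalFieldHaar.continuous_normAbs.comp (hac.sub continuous_const)) continuous_const)).inter ?_
    exact hαc.isOpen_inter_preimage hVo (isOpen_primePowBall N)
  have h1U : (1 : G) ∈ U := by
    refine ⟨⟨?_, ?_⟩, ?_, ?_⟩
    · simp only [mem_setOf_eq, mul_one, sub_self, map_zero]
      exact pos_iff_ne_zero.2 ((map_ne_zero _).2 hβ₀)
    · simp only [mem_setOf_eq, mul_one, sub_self, map_zero]
      exact pos_iff_ne_zero.2 ((map_ne_zero _).2 h1a₀)
    · simp only [hV, mem_setOf_eq, mul_one]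
      exact hβ₀
    · simp only [mem_preimage, mul_one, sub_self]
      exact zero_mem_primePowBall N
  obtain ⟨K₀, hK₀o, hK₀U⟩ := exists_openSubgroup_subset_of_isOpen hUo h1U
  refine ⟨K₀, hK₀o, Gv, m₀, hGv, fun k hk => ?_⟩
  obtain ⟨⟨hk₁, hk₂⟩, hk₃, hk₄⟩ := hK₀U hk
  have hβk : normAbs F (β (z₀ * k)) = normAbs F (β z₀) := normAbs_eq_of_normAbs_sub_lt' hk₁
  have hβk0 : β (z₀ * k) ≠ 0 := fun h => hβ₀ ((map_eq_zero (normAbs F)).1 (by rw [← hβk, h, map_zero]))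
  refine ⟨hβk0, hβk, normAbs_eq_of_normAbs_sub_lt' (φ := fun z => 1 - a z) hk₂, fun g c hg₁ hg₂ hB n hn => ?_⟩
  exact hval g (a (z₀ * k)) (β (z₀ * k)) c hg₁ hg₂ hB hβk0 hk₄ n hn

end Torus

end Literature.RepresentationTheory.HeisenbergGroup

end
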